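import Summits.HodgeConjecture.CorCM.CMEigenBasis
import Summits.HodgeConjecture.CorCM.ProductEigenbasis
import Summits.HodgeConjecture.CorCM.WeilGeneratorsIndependent
import Summits.HodgeConjecture.CorCM.WeilLineDiagonal
import Mathlib.RingTheory.Flat.Basic
import HarnessLib

/-!
# COR-CM model fact M15 `Fact_weilLine_rank`, scheme-level form: the Weil line of the corner product
# of four CM factors over a number field `K` has `ℚ`-dimension `[K:ℚ]`

HONEST FRAMING (cell pub-hodgecm2 / COR-CM): a STANDARD fact about the Betti cohomology of products of
complex abelian varieties with complex multiplication, on the tree's real carriers; no case of the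
Hodge conjecture is proved and nothing about algebraic cycles is asserted.

The stage-1 package `HodgeCMPerL` (`HodgeCM/Geometry/Universe.lean`) defines, for a CM field `K` and
four CM types `Φ₀,…,Φ₃`, the corner product `P = ((A_{Φ₀} × A_{Φ₁}) × A_{Φ₂}) × A_{Φ₃}`, its projections
`pr₀ = fst ≫ (fst ≫ fst)`, `pr₁ = fst ≫ (fst ≫ snd)`, `pr₂ = fst ≫ snd`, `pr₃ = snd`, the eigenlines
`H¹(A_{Φᵢ}, ℂ)_σ = ⋂ₑ ker((ι e) ⊗ ℂ − σ(e))` of the rational CM action `cmAct`, the WEIL GENERATORS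
`pr₀^*y₀ ∪ pr₁^*y₁ ∪ pr₂^*y₂ ∪ pr₃^*y₃` (all `yᵢ` in the SAME eigencharacter `σ`; complexified pull-backs
and cup products `pullC`, `cup2C = LinearMap.BilinMap.baseChange ℂ (cup X k k)`, `quadC`) and the WEIL LINE
`W_K(P) = {w ∈ H⁴(P, ℚ) | w ⊗ 1 ∈ span_ℂ(generators)}` (`weilLine`, via `HodgeStructure.ofRat`). Model axiom
M15 `Fact_weilLine_rank` (`HodgeCM/Geometry/Facts.lean`): `dim_ℚ W_K(P) = [K:ℚ]` (rfwf Def. 1.1; Deligne,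
LNM 900 §4; Moonen–Zarhin, Duke 77 (1995) §2). It is READ by the package's `Proofs/Prop22/Algebraic.lean`
(the cyclic-vector step of rfwf Prop. 2.2) and `StubTree/Qw8FaceBridge.lean`.

THIS FILE proves M15 in its scheme-level form `finrank_weilLine_eq` for four complex abelian varieties
`A i` with `ℚ`-algebra actions `ι i : K →ₐ[ℚ] End_ℚ H¹(Aᵢ(ℂ); ℚ)` satisfying the M12 shape (every joint
eigenspace of the complexified action is a line) and the M22 shape (`dim_ℚ H¹ = [K:ℚ]`) — exactly what the
stage-1 model universe `HodgeCM.Model.universeOf` provides for its `cmAV`/`cmAct` (its theorems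
`universeOf_fact_eigenLine`, `universeOf_fact_H1_rank`); the statement is written in the model's spelling
(`BettiUniverse.pull/cup`, `CartesianMonoidalCategory.fst/snd`, `LinearMap.baseChange ℂ`,
`Motives.HodgeStructure.ofRat`), so that the package-side junction is by unfolding.

Proof. (1) Eigenbases `ℓᵢ` of `ℂ ⊗ H¹(Aᵢ)` (`CorCM/CMEigenBasis`); (2) their pull-backs form a basis of
`ℂ ⊗ H¹(P)` (`CorCM/ProductEigenbasis`, Künneth); (3) the `σ`-generators `g_σ` built on it are linearly
independent (`CorCM/WeilGeneratorsIndependent`, `H⁴ = ⋀⁴ H¹`) and every Weil generator is a multiple of some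
`g_σ` (eigenlines are lines), so `dim_ℂ span(generators) = #Hom(K, ℂ) = [K:ℚ]` and `dim_ℚ W ≤ [K:ℚ]`
(`W ⊗ ℂ ↪ span`, flatness of `ℂ/ℚ`); (4) conversely `[K:ℚ]` linearly independent RATIONAL Weil classes are
produced by pairing `K`-translates of non-zero rational classes `uᵢ ∈ H¹(Aᵢ, ℚ)` through the trace-dual basis
of `K/ℚ` three times (`CorCM/WeilLineDiagonal`): their complexifications are `Σ_σ σ(e) c_σ g_σ` with ALL
`c_σ ≠ 0` (`repr_one_tmul_ne_zero`), and `e ↦ Σ_σ σ(e) c_σ g_σ` is injective.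

## References
* [Deligne1982HodgeCycles] P. Deligne, *Hodge cycles on abelian varieties*, LNM 900 (1982), §4.
* [MoonenZarhin1995] B. Moonen, Yu. Zarhin, Duke Math. J. 77 (1995), §2 (Weil classes `W_K`).
* [Shimura1998] G. Shimura, *Abelian Varieties with Complex Multiplication and Modular Functions* (1998), §3.2.
-/

noncomputable section

open scoped TensorProduct
open CategoryTheory MonoidalCategory CartesianMonoidalCategory Module
open Literature.AlgebraicTopology.SingularHomology
open Literature.AlgebraicGeometry Literature.AlgebraicGeometry.Motives Literature.AlgebraicGeometry.HodgeTheory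

namespace Summit.HodgeConjecture.CorCM.Model

section WeilLine

variable {K : Type} [Field K] [NumberField K]
variable (A : Fin 4 → AbelianVariety ℂ)
variable (ι : (i : Fin 4) → (K →ₐ[ℚ] Module.End ℚ (bettiCohomology (A i).X 1)))

/-- The joint `σ`-eigenspace of the complexified action on `ℂ ⊗ H¹(Aᵢ(ℂ); ℚ)` (the package's `eigenLine`). -/
local notation3 (prettyPrint := false) "EigL[" i ", " σ "]" =>
  (⨅ e : K, Module.End.eigenspace (LinearMap.baseChange ℂ ((ι i) e)) (σ e) :
    Submodule ℂ (ℂ ⊗[ℚ] bettiCohomology ((A i).X) 1))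

/-- The corner product scheme `P = ((A₀ ⊗ A₁) ⊗ A₂) ⊗ A₃` (the package's `prod4`). -/
local notation3 (prettyPrint := false) "PX" => ((((A 0).X ⊗ (A 1).X) ⊗ (A 2).X) ⊗ (A 3).X)
/-- `pr₀ = fst ≫ (fst ≫ fst)`. -/
local notation3 (prettyPrint := false) "pr₀" =>
  (fst (((A 0).X ⊗ (A 1).X) ⊗ (A 2).X) (A 3).X ≫ (fst ((A 0).X ⊗ (A 1).X) (A 2).X ≫ fst (A 0).X (A 1).X))
/-- `pr₁ = fst ≫ (fst ≫ snd)`. -/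
local notation3 (prettyPrint := false) "pr₁" =>
  (fst (((A 0).X ⊗ (A 1).X) ⊗ (A 2).X) (A 3).X ≫ (fst ((A 0).X ⊗ (A 1).X) (A 2).X ≫ snd (A 0).X (A 1).X))
/-- `pr₂ = fst ≫ snd`. -/
local notation3 (prettyPrint := false) "pr₂" =>
  (fst (((A 0).X ⊗ (A 1).X) ⊗ (A 2).X) (A 3).X ≫ snd ((A 0).X ⊗ (A 1).X) (A 2).X)
/-- `pr₃ = snd`. -/
local notation3 (prettyPrint := false) "pr₃" => (snd (((A 0).X ⊗ (A 1).X) ⊗ (A 2).X) (A 3).X)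
/-- Complexified pull-back in degree one (the package's `pullC f 1`). -/
local notation3 (prettyPrint := false) "pullC[" f "]" => (LinearMap.baseChange ℂ (BettiUniverse.pull f 1))
/-- Complexified cup product in equal degrees (the package's `cup2C X k`). -/
local notation3 (prettyPrint := false) "Cup[" k "]" =>
  (LinearMap.BilinMap.baseChange ℂ (BettiUniverse.cup ((((A 0).X ⊗ (A 1).X) ⊗ (A 2).X) ⊗ (A 3).X) k k))

/-- The set of WEIL GENERATORS of the corner product (the package's `weilGenerators K Φ`, unfolded on the
model): four-fold complexified cup products of pulled-back classes lying in the SAME eigencharacter. -/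
local notation3 (prettyPrint := false) "Gens" =>
  {x : ℂ ⊗[ℚ] bettiCohomology ((((A 0).X ⊗ (A 1).X) ⊗ (A 2).X) ⊗ (A 3).X) 4 |
    ∃ (σ : K →+* ℂ) (y : (i : Fin 4) → ℂ ⊗[ℚ] bettiCohomology ((A i).X) 1),
      (∀ i, y i ∈ EigL[i, σ]) ∧
      x = Cup[2] (Cup[1] (pullC[pr₀] (y 0)) (pullC[pr₁] (y 1))) (Cup[1] (pullC[pr₂] (y 2)) (pullC[pr₃] (y 3)))}

/-- `dim_ℂ (W ⊗ ℂ) = dim_ℚ W` for a `ℚ`-subspace (flatness of `ℂ/ℚ`). [folklore] -/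
theorem finrank_baseChange_eq' {V : Type*} [AddCommGroup V] [Module ℚ V] (W : Submodule ℚ V) :
    Module.finrank ℂ ↥(W.baseChange ℂ) = Module.finrank ℚ ↥W := by
  have hinj : Function.Injective ((W.subtype).baseChange ℂ) := by
    have h := Module.Flat.lTensor_preserves_injective_linearMap (M := ℂ) W.subtype W.injective_subtype
    intro a b hab
    exact h (by simpa [LinearMap.baseChange_eq_ltensor] using hab)
  rw [Submodule.baseChange, LinearMap.finrank_range_of_inj hinj, Module.finrank_baseChange]

/-- **Lower bound: `[K:ℚ]` linearly independent RATIONAL Weil classes.** Given eigenbases `ℓᵢ` of the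
four factors (M12/M22 shapes) and the `σ`-generators `g σ = ℓ₀σ ∪ ℓ₁σ ∪ ℓ₂σ ∪ ℓ₃σ` (pulled back to `P`,
linearly independent), the rational classes whose complexification lies in `span_ℂ {g σ}` have
`ℚ`-dimension at least `[K:ℚ]`: pair `K`-translates of non-zero rational classes `uᵢ ∈ H¹(Aᵢ; ℚ)` through the
trace-dual basis of `K/ℚ` (`one_tmul_sum_pairing_dual`, three times); the resulting rational classes `D(e)`
complexify to `Σ_σ σ(e) c_σ g σ` with all `c_σ ≠ 0`, and `e ↦ D(e)` is injective. [cite: Deligne1982HodgeCycles, §4] -/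
theorem finrank_le_finrank_weilLine_of_generators
    (hrk : ∀ i : Fin 4, Module.finrank ℚ (bettiCohomology ((A i).X) 1) = Module.finrank ℚ K)
    (ℓ : (i : Fin 4) → Module.Basis (K →+* ℂ) ℂ (ℂ ⊗[ℚ] bettiCohomology ((A i).X) 1))
    (hℓ : ∀ (i : Fin 4) (σ : K →+* ℂ), ℓ i σ ∈ EigL[i, σ])
    (g : (K →+* ℂ) → ℂ ⊗[ℚ] bettiCohomology ((((A 0).X ⊗ (A 1).X) ⊗ (A 2).X) ⊗ (A 3).X) 4)
    (hg' : ∀ σ, g σ = Cup[2] (Cup[1] (pullC[pr₀] (ℓ 0 σ)) (pullC[pr₁] (ℓ 1 σ)))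
      (Cup[1] (pullC[pr₂] (ℓ 2 σ)) (pullC[pr₃] (ℓ 3 σ))))
    (hg : LinearIndependent ℂ g) :
    Module.finrank ℚ K ≤ Module.finrank ℚ ↥(((Submodule.span ℂ (Set.range g)).restrictScalars ℚ).comap
      (Motives.HodgeStructure.ofRat :
        bettiCohomology ((((A 0).X ⊗ (A 1).X) ⊗ (A 2).X) ⊗ (A 3).X) 4 →ₗ[ℚ]
          ℂ ⊗[ℚ] bettiCohomology ((((A 0).X ⊗ (A 1).X) ⊗ (A 2).X) ⊗ (A 3).X) 4)) := by
  classical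
  have hXi : ∀ i : Fin 4, IsSmoothProjective (A i).dim (A i).X :=
    fun i ↦ AbelianVariety.isSmoothProjective_holds (A := A i)
  have hfin1 : ∀ i : Fin 4, FiniteDimensional ℚ (bettiCohomology ((A i).X) 1) :=
    fun i ↦ finiteDimensional_bettiCohomology (hXi i) 1
  have hP : IsSmoothProjective ((((A 0).prod (A 1)).prod (A 2)).prod (A 3)).dim PX :=
    AbelianVariety.isSmoothProjective_holds (A := (((A 0).prod (A 1)).prod (A 2)).prod (A 3))
  have hfin4 : FiniteDimensional ℚ (bettiCohomology PX 4) := finiteDimensional_bettiCohomology hP 4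
  have hcardE : Fintype.card (K →+* ℂ) = Module.finrank ℚ K := NumberField.Embeddings.card K ℂ
  have hσ₀ : Nonempty (K →+* ℂ) := by
    rw [← Fintype.card_pos_iff, hcardE]; exact Module.finrank_pos
  obtain ⟨σ₀⟩ := hσ₀
  set W := ((Submodule.span ℂ (Set.range g)).restrictScalars ℚ).comap
      (Motives.HodgeStructure.ofRat :
        bettiCohomology ((((A 0).X ⊗ (A 1).X) ⊗ (A 2).X) ⊗ (A 3).X) 4 →ₗ[ℚ]
          ℂ ⊗[ℚ] bettiCohomology ((((A 0).X ⊗ (A 1).X) ⊗ (A 2).X) ⊗ (A 3).X) 4) with hW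
  have hmemW : ∀ w, w ∈ W ↔ (1 : ℂ) ⊗ₜ[ℚ] w ∈ Submodule.span ℂ (Set.range g) := fun w ↦ Iff.rfl
  /- (≥) `[K:ℚ]` linearly independent RATIONAL Weil classes -/
  -- non-zero rational classes on the factors and their (non-zero) eigen-coordinates
  have hu : ∀ i : Fin 4, ∃ u : bettiCohomology ((A i).X) 1, u ≠ 0 := by
    intro i
    haveI := hfin1 i
    have h : 0 < Module.finrank ℚ (bettiCohomology ((A i).X) 1) := by rw [hrk i]; exact Module.finrank_pos
    exact Module.finrank_pos_iff_exists_ne_zero.1 h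
  choose u hu0 using hu
  obtain ⟨a, ha_def⟩ : ∃ a : Fin 4 → (K →+* ℂ) → ℂ, ∀ i σ, a i σ = (ℓ i).repr ((1 : ℂ) ⊗ₜ[ℚ] u i) σ :=
    ⟨fun i σ ↦ (ℓ i).repr ((1 : ℂ) ⊗ₜ[ℚ] u i) σ, fun _ _ ↦ rfl⟩
  have ha : ∀ i σ, a i σ ≠ 0 := fun i σ ↦ by
    haveI := hfin1 i
    rw [ha_def]
    exact repr_one_tmul_ne_zero (ι i) (hrk i) (ℓ i) (hℓ i) (hu0 i) σ
  have hdiag : ∀ (i : Fin 4) (e : K),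
      (1 : ℂ) ⊗ₜ[ℚ] ((ι i) e (u i)) = ∑ σ : K →+* ℂ, (σ e * a i σ) • ℓ i σ := by
    intro i e
    have hrepr : ∀ σ : K →+* ℂ, (ℓ i).repr (((ι i) e).baseChange ℂ ((1 : ℂ) ⊗ₜ[ℚ] u i)) σ = σ e * a i σ := by
      intro σ
      rw [ha_def]
      exact repr_baseChange_ι_apply (ι i) (ℓ i) (hℓ i) e _ σ
    rw [← LinearMap.baseChange_tmul]
    conv_lhs => rw [← (ℓ i).sum_repr (((ι i) e).baseChange ℂ ((1 : ℂ) ⊗ₜ[ℚ] u i))]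
    exact Finset.sum_congr rfl fun σ _ ↦ by rw [hrepr σ]
  -- the rational maps `e ↦ prₖ^* (ιₖ(e) uₖ)` and their diagonal complexifications
  let x0 : K →ₗ[ℚ] bettiCohomology PX 1 := BettiUniverse.pull pr₀ 1 ∘ₗ (LinearMap.applyₗ (u 0) ∘ₗ (ι 0).toLinearMap)
  let x1 : K →ₗ[ℚ] bettiCohomology PX 1 := BettiUniverse.pull pr₁ 1 ∘ₗ (LinearMap.applyₗ (u 1) ∘ₗ (ι 1).toLinearMap)
  let x2 : K →ₗ[ℚ] bettiCohomology PX 1 := BettiUniverse.pull pr₂ 1 ∘ₗ (LinearMap.applyₗ (u 2) ∘ₗ (ι 2).toLinearMap)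
  let x3 : K →ₗ[ℚ] bettiCohomology PX 1 := BettiUniverse.pull pr₃ 1 ∘ₗ (LinearMap.applyₗ (u 3) ∘ₗ (ι 3).toLinearMap)
  have hx0 : ∀ e, (1 : ℂ) ⊗ₜ[ℚ] x0 e = ∑ σ : K →+* ℂ, (σ e * a 0 σ) • pullC[pr₀] (ℓ 0 σ) := by
    intro e
    change (1 : ℂ) ⊗ₜ[ℚ] (BettiUniverse.pull pr₀ 1 ((ι 0) e (u 0))) = _
    rw [← LinearMap.baseChange_tmul, hdiag, map_sum]
    simp only [map_smul]
  have hx1 : ∀ e, (1 : ℂ) ⊗ₜ[ℚ] x1 e = ∑ σ : K →+* ℂ, (σ e * a 1 σ) • pullC[pr₁] (ℓ 1 σ) := by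
    intro e
    change (1 : ℂ) ⊗ₜ[ℚ] (BettiUniverse.pull pr₁ 1 ((ι 1) e (u 1))) = _
    rw [← LinearMap.baseChange_tmul, hdiag, map_sum]
    simp only [map_smul]
  have hx2 : ∀ e, (1 : ℂ) ⊗ₜ[ℚ] x2 e = ∑ σ : K →+* ℂ, (σ e * a 2 σ) • pullC[pr₂] (ℓ 2 σ) := by
    intro e
    change (1 : ℂ) ⊗ₜ[ℚ] (BettiUniverse.pull pr₂ 1 ((ι 2) e (u 2))) = _
    rw [← LinearMap.baseChange_tmul, hdiag, map_sum]
    simp only [map_smul]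
  have hx3 : ∀ e, (1 : ℂ) ⊗ₜ[ℚ] x3 e = ∑ σ : K →+* ℂ, (σ e * a 3 σ) • pullC[pr₃] (ℓ 3 σ) := by
    intro e
    change (1 : ℂ) ⊗ₜ[ℚ] (BettiUniverse.pull pr₃ 1 ((ι 3) e (u 3))) = _
    rw [← LinearMap.baseChange_tmul, hdiag, map_sum]
    simp only [map_smul]
  -- the trace-dual basis of `K/ℚ`
  let bK := Module.finBasis ℚ K
  let dK := (Algebra.traceForm ℚ K).dualBasis (traceForm_nondegenerate ℚ K) bK
  have hbd : ∀ σ τ : K →+* ℂ, ∑ i, σ (bK i) * τ (dK i) = if σ = τ then 1 else 0 :=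
    fun σ τ ↦ sum_embedding_mul_embedding_dual bK σ τ
  -- pairing two `ℚ`-linear maps through the trace-dual basis, as a `ℚ`-linear map of `e`
  have pair : ∀ {V₁ V₃ : Type} [AddCommGroup V₁] [Module ℚ V₁] [AddCommGroup V₃] [Module ℚ V₃]
      (B : LinearMap.BilinMap ℚ V₁ V₃) (x y : K →ₗ[ℚ] V₁),
      ∃ D : K →ₗ[ℚ] V₃, ∀ e, D e = ∑ i, B (x (e * bK i)) (y (dK i)) := by
    intro V₁ V₃ _ _ _ _ B x y
    refine ⟨∑ i, (B.flip (y (dK i))) ∘ₗ x ∘ₗ LinearMap.mulRight ℚ (bK i), fun e ↦ ?_⟩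
    simp only [LinearMap.coe_sum, Finset.sum_apply, LinearMap.comp_apply, LinearMap.mulRight_apply,
      LinearMap.flip_apply]
  -- step A: factors 0 and 1
  obtain ⟨D01, hD01⟩ := pair (BettiUniverse.cup PX 1 1) x0 x1
  have hD01d : ∀ e, (1 : ℂ) ⊗ₜ[ℚ] D01 e =
      ∑ σ : K →+* ℂ, (σ e * (a 0 σ * a 1 σ)) • Cup[1] (pullC[pr₀] (ℓ 0 σ)) (pullC[pr₁] (ℓ 1 σ)) := by
    intro e
    rw [hD01]
    exact one_tmul_sum_pairing_dual bK dK hbd (BettiUniverse.cup PX 1 1) x0 x1 _ _ (a 0) (a 1) hx0 hx1 e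
  -- step B: factors 2 and 3
  obtain ⟨D23, hD23⟩ := pair (BettiUniverse.cup PX 1 1) x2 x3
  have hD23d : ∀ e, (1 : ℂ) ⊗ₜ[ℚ] D23 e =
      ∑ σ : K →+* ℂ, (σ e * (a 2 σ * a 3 σ)) • Cup[1] (pullC[pr₂] (ℓ 2 σ)) (pullC[pr₃] (ℓ 3 σ)) := by
    intro e
    rw [hD23]
    exact one_tmul_sum_pairing_dual bK dK hbd (BettiUniverse.cup PX 1 1) x2 x3 _ _ (a 2) (a 3) hx2 hx3 e
  -- step C: the two halves
  obtain ⟨D, hD⟩ := pair (BettiUniverse.cup PX 2 2) D01 D23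
  have hDd : ∀ e, (1 : ℂ) ⊗ₜ[ℚ] D e =
      ∑ σ : K →+* ℂ, (σ e * (a 0 σ * a 1 σ * (a 2 σ * a 3 σ))) • g σ := by
    intro e
    rw [hD, one_tmul_sum_pairing_dual bK dK hbd (BettiUniverse.cup PX 2 2) D01 D23 _ _
      (fun σ ↦ a 0 σ * a 1 σ) (fun σ ↦ a 2 σ * a 3 σ) hD01d hD23d e]
    refine Finset.sum_congr rfl fun σ _ ↦ ?_
    rw [hg' σ]
  -- the rational classes `D e` are Weil classes
  have hDW : ∀ e, D e ∈ W := by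
    intro e
    rw [hmemW, hDd]
    exact Submodule.sum_mem _ fun σ _ ↦ Submodule.smul_mem _ _ (Submodule.subset_span ⟨σ, rfl⟩)
  -- and `m ↦ D (b m)` is linearly independent
  have hDind : LinearIndependent ℚ fun m ↦ D (bK m) := by
    rw [Fintype.linearIndependent_iff]
    intro q hq m
    set z : K := ∑ m, q m • bK m with hz
    have hDz : D z = 0 := by
      rw [hz, map_sum]
      simpa only [map_smul] using hq
    have hcoef : ∀ σ : K →+* ℂ, σ z * (a 0 σ * a 1 σ * (a 2 σ * a 3 σ)) = 0 := by
      have h0 : ∑ σ : K →+* ℂ, (σ z * (a 0 σ * a 1 σ * (a 2 σ * a 3 σ))) • g σ = 0 := by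
        rw [← hDd, hDz, TensorProduct.tmul_zero]
      exact Fintype.linearIndependent_iff.1 hg _ h0
    have hz0 : z = 0 := by
      have h := hcoef σ₀
      have hne : a 0 σ₀ * a 1 σ₀ * (a 2 σ₀ * a 3 σ₀) ≠ 0 :=
        mul_ne_zero (mul_ne_zero (ha 0 σ₀) (ha 1 σ₀)) (mul_ne_zero (ha 2 σ₀) (ha 3 σ₀))
      have : σ₀ z = 0 := (mul_eq_zero.1 h).resolve_right hne
      exact (map_eq_zero_iff σ₀ σ₀.injective).1 this
    exact Fintype.linearIndependent_iff.1 bK.linearIndependent q (by rw [← hz]; exact hz0) m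
  -- lift to `W` and count
  have hDindW : LinearIndependent ℚ fun m ↦ (⟨D (bK m), hDW (bK m)⟩ : ↥W) :=
    LinearIndependent.of_comp W.subtype (by exact hDind)
  haveI := hfin4
  have hcount := hDindW.fintype_card_le_finrank
  rwa [Fintype.card_fin] at hcount
set_option maxHeartbeats 400000 in
/-- **Model axiom M15 (`Fact_weilLine_rank`), scheme-level form.** For four complex abelian varieties
`A₀,…,A₃` with `ℚ`-algebra actions `ιᵢ : K → End_ℚ H¹(Aᵢ(ℂ); ℚ)` of a number field `K` such that every
joint eigenspace of the complexified action is a line (M12 shape) and `dim_ℚ H¹(Aᵢ(ℂ); ℚ) = [K:ℚ]`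
(M22 shape), the Weil line of the corner product `P = ((A₀ ⊗ A₁) ⊗ A₂) ⊗ A₃` — the rational classes of
`H⁴(P(ℂ); ℚ)` whose complexification lies in the `ℂ`-span of the Weil generators — has `ℚ`-dimension
`[K:ℚ]`. [cite: Deligne1982HodgeCycles, §4] [cite: MoonenZarhin1995, §2] -/
theorem finrank_weilLine_eq
    (hline : ∀ (i : Fin 4) (σ : K →+* ℂ), Module.finrank ℂ ↥(EigL[i, σ]) = 1)
    (hrk : ∀ i : Fin 4, Module.finrank ℚ (bettiCohomology ((A i).X) 1) = Module.finrank ℚ K) :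
    Module.finrank ℚ ↥(((Submodule.span ℂ Gens).restrictScalars ℚ).comap
      (Motives.HodgeStructure.ofRat :
        bettiCohomology ((((A 0).X ⊗ (A 1).X) ⊗ (A 2).X) ⊗ (A 3).X) 4 →ₗ[ℚ]
          ℂ ⊗[ℚ] bettiCohomology ((((A 0).X ⊗ (A 1).X) ⊗ (A 2).X) ⊗ (A 3).X) 4)) =
      Module.finrank ℚ K := by
  classical
  /- (0) preliminaries -/
  have hXi : ∀ i : Fin 4, IsSmoothProjective (A i).dim (A i).X :=
    fun i ↦ AbelianVariety.isSmoothProjective_holds (A := A i)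
  have hfin1 : ∀ i : Fin 4, FiniteDimensional ℚ (bettiCohomology ((A i).X) 1) :=
    fun i ↦ finiteDimensional_bettiCohomology (hXi i) 1
  have hP : IsSmoothProjective ((((A 0).prod (A 1)).prod (A 2)).prod (A 3)).dim PX :=
    AbelianVariety.isSmoothProjective_holds (A := (((A 0).prod (A 1)).prod (A 2)).prod (A 3))
  have hfin4 : FiniteDimensional ℚ (bettiCohomology PX 4) := finiteDimensional_bettiCohomology hP 4
  have hcardE : Fintype.card (K →+* ℂ) = Module.finrank ℚ K := NumberField.Embeddings.card K ℂ
  /- (1) eigenbases of the four factors -/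
  have hex : ∀ i : Fin 4, ∃ ℓ : Basis (K →+* ℂ) ℂ (ℂ ⊗[ℚ] bettiCohomology ((A i).X) 1),
      ∀ σ, ℓ σ ∈ EigL[i, σ] := fun i ↦ by
    haveI := hfin1 i
    exact exists_eigenBasis (ι i) (hline i) (hrk i)
  choose ℓ hℓ using hex
  /- (2) the product basis of `ℂ ⊗ H¹(P)` -/
  have hind := linearIndependent_prod4 (hXi 0) (hXi 1) (hXi 2) (hXi 3)
    (ℓ 0).linearIndependent (ℓ 1).linearIndependent (ℓ 2).linearIndependent (ℓ 3).linearIndependent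
  have hcard : Fintype.card ((((K →+* ℂ) ⊕ (K →+* ℂ)) ⊕ (K →+* ℂ)) ⊕ (K →+* ℂ)) =
      Module.finrank ℂ (ℂ ⊗[ℚ] bettiCohomology PX 1) := by
    rw [finrank_complexified_bettiCohomology_one_prod4 (hXi 0) (hXi 1) (hXi 2) (hXi 3), hrk 0, hrk 1,
      hrk 2, hrk 3]
    simp only [Fintype.card_sum, hcardE]
  let bP := basisOfLinearIndependentOfCardEqFinrank hind hcard
  have hbP : ⇑bP = Sum.elim (Sum.elim (Sum.elim (fun σ ↦ pullC[pr₀] (ℓ 0 σ)) (fun σ ↦ pullC[pr₁] (ℓ 1 σ)))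
      (fun σ ↦ pullC[pr₂] (ℓ 2 σ))) (fun σ ↦ pullC[pr₃] (ℓ 3 σ)) :=
    coe_basisOfLinearIndependentOfCardEqFinrank hind hcard
  -- the four index maps into the product index type
  let j : Fin 4 → (K →+* ℂ) → ((((K →+* ℂ) ⊕ (K →+* ℂ)) ⊕ (K →+* ℂ)) ⊕ (K →+* ℂ)) :=
    ![fun σ ↦ Sum.inl (Sum.inl (Sum.inl σ)), fun σ ↦ Sum.inl (Sum.inl (Sum.inr σ)),
      fun σ ↦ Sum.inl (Sum.inr σ), fun σ ↦ Sum.inr σ]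
  have hj0 : ∀ σ, bP (j 0 σ) = pullC[pr₀] (ℓ 0 σ) := fun σ ↦ by rw [hbP]; rfl
  have hj1 : ∀ σ, bP (j 1 σ) = pullC[pr₁] (ℓ 1 σ) := fun σ ↦ by rw [hbP]; rfl
  have hj2 : ∀ σ, bP (j 2 σ) = pullC[pr₂] (ℓ 2 σ) := fun σ ↦ by rw [hbP]; rfl
  have hj3 : ∀ σ, bP (j 3 σ) = pullC[pr₃] (ℓ 3 σ) := fun σ ↦ by rw [hbP]; rfl
  have hj : ∀ k k' σ τ, j k σ = j k' τ → k = k' ∧ σ = τ := by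
    intro k k' σ τ h
    fin_cases k <;> fin_cases k' <;> simp_all [j]
  /- (3) the `σ`-generators: independent, and they span the span of all generators -/
  let g : (K →+* ℂ) → ℂ ⊗[ℚ] bettiCohomology PX 4 := fun σ ↦
    Cup[2] (Cup[1] (bP (j 0 σ)) (bP (j 1 σ))) (Cup[1] (bP (j 2 σ)) (bP (j 3 σ)))
  have hg : LinearIndependent ℂ g := linearIndependent_quadC ((((A 0).prod (A 1)).prod (A 2)).prod (A 3)) bP j hj
  have hg' : ∀ σ, g σ = Cup[2] (Cup[1] (pullC[pr₀] (ℓ 0 σ)) (pullC[pr₁] (ℓ 1 σ)))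
      (Cup[1] (pullC[pr₂] (ℓ 2 σ)) (pullC[pr₃] (ℓ 3 σ))) := fun σ ↦ by
    simp only [g, hj0, hj1, hj2, hj3]
  have hS : Submodule.span ℂ Gens = Submodule.span ℂ (Set.range g) := by
    apply le_antisymm
    · rw [Submodule.span_le]
      rintro x ⟨σ, y, hy, rfl⟩
      obtain ⟨t0, ht0⟩ := eq_smul_of_mem_eigenLine (ι 0) (hline 0) (ℓ 0) (hℓ 0) σ (hy 0)
      obtain ⟨t1, ht1⟩ := eq_smul_of_mem_eigenLine (ι 1) (hline 1) (ℓ 1) (hℓ 1) σ (hy 1)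
      obtain ⟨t2, ht2⟩ := eq_smul_of_mem_eigenLine (ι 2) (hline 2) (ℓ 2) (hℓ 2) σ (hy 2)
      obtain ⟨t3, ht3⟩ := eq_smul_of_mem_eigenLine (ι 3) (hline 3) (ℓ 3) (hℓ 3) σ (hy 3)
      rw [ht0, ht1, ht2, ht3]
      simp only [map_smul, LinearMap.smul_apply, SetLike.mem_coe]
      exact Submodule.smul_mem _ _ (Submodule.smul_mem _ _
        (Submodule.smul_mem _ _ (Submodule.smul_mem _ _ (Submodule.subset_span ⟨σ, hg' σ⟩))))
    · rw [Submodule.span_le]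
      rintro _ ⟨σ, rfl⟩
      exact Submodule.subset_span ⟨σ, fun i ↦ ℓ i σ, fun i ↦ hℓ i σ, hg' σ⟩
  have hSrank0 : Module.finrank ℂ ↥(Submodule.span ℂ (Set.range g)) = Module.finrank ℚ K := by
    rw [finrank_span_eq_card hg, hcardE]
  /- Everything below is about `S = span (range g)`; the goal's span of ALL generators enters only through `hS`. -/
  suffices key : ∀ S : Submodule ℂ (ℂ ⊗[ℚ] bettiCohomology PX 4), S = Submodule.span ℂ (Set.range g) →
      Module.finrank ℚ ↥((S.restrictScalars ℚ).comap
        (Motives.HodgeStructure.ofRat :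
          bettiCohomology ((((A 0).X ⊗ (A 1).X) ⊗ (A 2).X) ⊗ (A 3).X) 4 →ₗ[ℚ]
            ℂ ⊗[ℚ] bettiCohomology ((((A 0).X ⊗ (A 1).X) ⊗ (A 2).X) ⊗ (A 3).X) 4)) = Module.finrank ℚ K by
    exact key _ hS
  rintro S rfl
  set W := ((Submodule.span ℂ (Set.range g)).restrictScalars ℚ).comap
      (Motives.HodgeStructure.ofRat :
        bettiCohomology ((((A 0).X ⊗ (A 1).X) ⊗ (A 2).X) ⊗ (A 3).X) 4 →ₗ[ℚ]
          ℂ ⊗[ℚ] bettiCohomology ((((A 0).X ⊗ (A 1).X) ⊗ (A 2).X) ⊗ (A 3).X) 4) with hW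
  have hmemW : ∀ w, w ∈ W ↔ (1 : ℂ) ⊗ₜ[ℚ] w ∈ Submodule.span ℂ (Set.range g) := fun w ↦ Iff.rfl
  /- (≤) `W ⊗ ℂ` embeds into the span of the generators -/
  have hle : Module.finrank ℚ ↥W ≤ Module.finrank ℚ K := by
    haveI := hfin4
    rw [← hSrank0, ← finrank_baseChange_eq' W]
    apply Submodule.finrank_mono
    rw [Submodule.baseChange_eq_span, Submodule.span_le]
    rintro _ ⟨w, hw, rfl⟩
    exact (hmemW w).1 hw
  refine le_antisymm hle ?_
  exact finrank_le_finrank_weilLine_of_generators A ι hrk ℓ hℓ g hg' hg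

end WeilLine

end Summit.HodgeConjecture.CorCM.Model

end
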